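import Summits.QuantumFields.YangMills.Theorems.LuscherReductionDressedRitzLiftLeakageBasisGeneric
import Summits.QuantumFields.YangMills.Theorems.LuscherReductionDressedRitzPolyakovLiftBasisGenericL
import Summits.QuantumFields.YangMills.Theorems.LuscherReductionDressedRitzPolyakovLiftTransplantRoot
import HarnessLib

/-!
# Crux `DressedRitz` (stmt-QuantumFields-20205), line «polyakovlift» r6, stub S-LEAK `stub_liftLeakage` — support XXIV:
# the S-LEAK closing package for an `L`-ADAPTED basis predicate `P L Λ g`, and the REGISTERED r6 text `∀ k, LeakageForL (TransplantBasisL k)` BY NAME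

Support module (fleet seat ym-20205-polyakovlift-s1 gen 2; `--supports stmt-QuantumFields-20205`, helper, no closure claim).  Skeleton r6 of the line
(«explicit transplanted observables», REGISTERED 2026-08-27T18:29Z, sha16 09c950a55cd7b1f3) reads S-LEAK as
`Stmt.stub_liftLeakage := ∀ k, LeakageForL (TransplantBasisL k)`: the basis-parametric text of `…PolyakovLiftBasisGenericL.lean` (p554440) at the root-transplant
predicate `TransplantBasisL k L Λ g` (p554989; `g_i = (χ_R·f_{i+1}/f_0) ∘ rootCoord L (Λ/2)`, `f` an AL1 eigenfamily of Lüscher's matrix Hamiltonian with `f_0 > 0`,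
radius pinned `1/8 ≤ RΛ ≤ 1/4`).  The predicate reads the lattice size `L` (through its chart), so the `L`-blind package of support XXII
(`…LiftLeakageBasisGeneric.lean`, p555044: `SlowOutsideCoreFor ∕ FirstMomentCoreFor ∕ EuclideanLeakageFor P` for `P Λ g`) is restated here for `P L Λ g` — same
bodies with `P (λ(β,L)) g ↦ P L (λ(β,L)) g`, same ten-line proofs (per lattice point XIV `leakageClause_dressed_of_slow_outside` at the Perron–Frobenius vacuum,
then `leakageClause_iterate_iff`; XII `leakageClause_iff_euclidean`) — and instantiated at the registered predicate:

* §1 `…L_const_iff` — an `L`-blind predicate `fun _ => P` gives back the XXII cores (`Iff.rfl`); `leakageForL_of_imp` — antitone in `P`;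
* §2 `leakageForL_of_residualLaw`; §3 `SlowOutsideCoreForL P` + ★★★ `leakageForL_of_slowOutsideCoreForL` (NO statics ∕ universality ∕ width ∕ Gram input);
  §4 `FirstMomentCoreForL P` + `slowOutsideCoreForL_of_firstMomentCoreForL` + ★★★ `leakageForL_of_firstMomentCoreForL`; §5 `EuclideanLeakageForL P` +
  `leakageForL_iff_euclideanForL`; §6 the cores are antitone in `P`;
* §7 THE REGISTERED TEXT BY NAME: ★★★ `r6Leakage_of_firstMomentCoreForL : (∀ k, FirstMomentCoreForL (TransplantBasisL k)) → ∀ k, LeakageForL (TransplantBasisL k)`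
  (= `Stmt.stub_liftLeakage` of skeleton r6 after unfolding the `abbrev`), `r6Leakage_of_slowOutsideCoreForL`, `r6Leakage_iff_euclidean`, `r6Leakage_of_imp`
  (sub-predicates inherit), `leakageForL_zero` (`k = 0` trivial).

So the r6 crux-map row is «S-LEAK ⟸ `r6Leakage_of_firstMomentCoreForL` ⟸ ■ `FirstMomentCoreForL (TransplantBasisL k)` (∀ k)»: per root-transplanted observable and
lattice point, on the UNDRESSED flowed-Polyakov insertion state `x_i = liftVec β Ω g_i`: (NEAR₁) first-moment band admixture budget `O(λ²/L)` relative to the own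
dressed weight, (BAND) band levers `O(λ/L)λ₀`, (OUT) `L`-uniform out-of-band weight `O(λ³)` — OPEN renormalisation-group estimates, unchanged in physics since r3;
in r6 the rotation freedom of `IsEigenFamily` inside the `SO(3)`-multiplets of `𝔥` (split on the lattice into cubic rows) is absorbed per member by (NEAR₁)+(BAND)
with the own index at the heavier cubic partner (the intra-multiplet fine splitting is level information of relative order `λ²`, inside (BAND)).

HONEST FRAMING: definitions + quantifier plumbing at fixed lattice on the conditional femto rung R2b1; the registered `stub_liftLeakage` stays OPEN (not in print);
nothing here bears on infinite volume, the continuum limit or the Clay gap.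
References: M. Lüscher, NPB 219 (1983) 233 [cite: Luscher1983, §3]; M. Lüscher, U. Wolff, NPB 339 (1990) 222 [cite: LuscherWolff1990, §2];
T. Kato, J. Phys. Soc. Japan 4 (1949) 334 [cite: Kato1949, §1]; M. Reed, B. Simon IV (1978) Thm XIII.1 [cite: ReedSimonIV1978].
-/

set_option autoImplicit false

noncomputable section

open MeasureTheory Filter Topology Finset
open Literature.MathematicalPhysics.QuantumFieldTheory
open Literature.MathematicalPhysics.QuantumLattice
open scoped BigOperators

namespace Summit.QuantumFields.YangMills.Theorems.FemtoTransferGap.LiftLeak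

open Summit.QuantumFields.YangMills.Theorems.FemtoTransferGap
open Summit.QuantumFields.YangMills.Theorems.FemtoTransferGap.PolyakovLift
open Summit.QuantumFields.YangMills.Theorems.FemtoTransferGap.VacDict

variable {k : ℕ}

/-! ## §1 Monotonicity in the predicate -/

/-- **`LeakageForL` is antitone in the basis predicate**: if every `P`-basis is a `P'`-basis then `LeakageForL P' → LeakageForL P` (same constants). [folklore] -/
theorem leakageForL_of_imp {P P' : ℕ → ℝ → (Fin k → (GaugeConfig 3 1 SU2 → ℝ)) → Prop} (hPP' : ∀ L Λ g, P L Λ g → P' L Λ g)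
    (h : LeakageForL P') : LeakageForL P := by
  obtain ⟨C, lam0, hC, hlam0, hk⟩ := h
  refine ⟨C, lam0, hC, hlam0, fun lam hlam hle => ?_⟩
  obtain ⟨L0, hL⟩ := hk lam hlam hle
  exact ⟨L0, fun L _ hL0 β hW φ hφ g hg => hL L hL0 β hW φ hφ g (hPP' _ _ _ hg)⟩

/-! ## §2 `LeakageForL P` from a per-member dressed residual law -/

/-- **`LeakageForL P` from a per-member RESIDUAL LAW at the Perron–Frobenius vacuum package**: eventually in the window, at `(Ω, θ, c)` (`IsVacuum`,
`Ω ≥ c > 0`), for every `P`-basis `g` and every channel `i` an approximate eigenvalue `a` with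
`‖K_β u_i − a·u_i‖² ≤ C(λ³/L²)λ₀²‖u_i‖²`, `u_i = dressedLiftVec β Ω g_i` (members physical).  The clause at an arbitrary raw vacuum `φ = ±Ω` follows
by `leakageClause_iterate_iff`. [cite: Kato1949, §1] [cite: Luscher1983, §3] -/
theorem leakageForL_of_residualLaw {P : ℕ → ℝ → (Fin k → (GaugeConfig 3 1 SU2 → ℝ)) → Prop} (hP : BasisPhysL P)
    (h : ∃ C lam0 : ℝ, 0 ≤ C ∧ 0 < lam0 ∧ ∀ lam : ℝ, 0 < lam → lam ≤ lam0 → ∃ L0 : ℕ,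
      ∀ (L : ℕ) [NeZero L], L0 ≤ L → ∀ β : ℝ, InFemtoWindow lam β L →
        ∀ (Ω : physSubmodule L) (θ c : ℝ), IsVacuum β Ω θ → 0 < c → (∀ U, c ≤ (Ω : GaugeConfig 3 L SU2 → ℝ) U) →
          ∀ g : Fin k → (GaugeConfig 3 1 SU2 → ℝ), P L (luscherLambda β L) g →
            ∀ i : Fin k, ∃ a : ℝ,
              l2 (transferApply β (dressedLiftVec β (Ω : GaugeConfig 3 L SU2 → ℝ) (g i)) - a • dressedLiftVec β (Ω : GaugeConfig 3 L SU2 → ℝ) (g i))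
                  (transferApply β (dressedLiftVec β (Ω : GaugeConfig 3 L SU2 → ℝ) (g i)) - a • dressedLiftVec β (Ω : GaugeConfig 3 L SU2 → ℝ) (g i)) ≤
                C * (luscherLambda β L ^ 3 / (L : ℝ) ^ 2) * levelValue su2Rep L β 0 ^ 2 *
                  l2 (dressedLiftVec β (Ω : GaugeConfig 3 L SU2 → ℝ) (g i)) (dressedLiftVec β (Ω : GaugeConfig 3 L SU2 → ℝ) (g i))) :
    LeakageForL P := by
  obtain ⟨C, lam0, hC, hlam0, hk⟩ := h
  refine ⟨C, lam0, hC, hlam0, fun lam hlam hle => ?_⟩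
  obtain ⟨L0, hL⟩ := hk lam hlam hle
  refine ⟨L0, fun L _ hL0 β hW φ hφ g hg => ?_⟩
  obtain ⟨Ω, θ, c, hV, hc, hcle⟩ := exists_isVacuum (L := L) β
  have hΩclause : LeakageClause k C β (dressedLiftFamily β (Ω : GaugeConfig 3 L SU2 → ℝ) g) :=
    leakageClause_dressed_of_residual C β hV.raw.1 (hP _ _ _ hg) (hL L hL0 β hW Ω θ c hV hc hcle g hg)
  exact (leakageClause_iterate_iff hV hφ (dressSteps L) C g).2 hΩclause

/-! ## §3 The located core PER BASIS MEMBER: `SlowOutsideCoreForL P` -/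

/-- **`SlowOutsideCoreForL P`** — the located renormalisation-group core of `LeakageForL P`, asked per `P`-basis member: constants `C ≥ 0`, `lam0 > 0`;
eventually in the femto window, at the Perron–Frobenius package `(Ω, θ, c)`, for every `P`-basis `g` (read at `(L, Λ = λ(β,L))`) and every channel `i`:
ONE exact physical `l2`-orthonormal fine eigenfamily `χ_0 … χ_{M−1}` of `K_β` (levels `μ_j`, dominating at `Λ ≥ 0`), an own index `j₀`
(`Λ ≤ μ_{j₀} ≤ λ₀`, kinematic gap `(L+1)²Λ^{2L} ≤ μ_{j₀}^{2L}` — free, `exists_eigenfamily_below`), a slow set `S` (`μ_j ≤ μ_{j₀}` off `S`), constants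
`C₁, C₂ ≥ 0` with `C₁ + C₂ ≤ C`, and on the UNDRESSED insertion state `x_i = liftVec β Ω g_i`:
(SLOW) `Σ_{j∈S}(μ_j − μ_{j₀})²μ_j^{2L}⟨x_i,χ_j⟩² ≤ C₁(λ³/L²)λ₀²·μ_{j₀}^{2L}⟨x_i,χ_{j₀}⟩²` and (OUT) `‖x_i‖² − Σ_{j∈S}⟨x_i,χ_j⟩² ≤ C₂λ³·⟨x_i,χ_{j₀}⟩²`.
[cite: Luscher1983, §3] [cite: LuscherWolff1990, §2] -/
def SlowOutsideCoreForL (P : ℕ → ℝ → (Fin k → (GaugeConfig 3 1 SU2 → ℝ)) → Prop) : Prop :=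
  ∃ C lam0 : ℝ, 0 ≤ C ∧ 0 < lam0 ∧ ∀ lam : ℝ, 0 < lam → lam ≤ lam0 → ∃ L0 : ℕ,
    ∀ (L : ℕ) [NeZero L], L0 ≤ L → ∀ β : ℝ, InFemtoWindow lam β L →
      ∀ (Ω : physSubmodule L) (θ c : ℝ), IsVacuum β Ω θ → 0 < c → (∀ U, c ≤ (Ω : GaugeConfig 3 L SU2 → ℝ) U) →
        ∀ g : Fin k → (GaugeConfig 3 1 SU2 → ℝ), P L (luscherLambda β L) g →
          ∀ i : Fin k, ∃ (M : ℕ) (χ : Fin M → (GaugeConfig 3 L SU2 → ℝ)) (μ : Fin M → ℝ) (Λ : ℝ) (j₀ : Fin M) (S : Finset (Fin M))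
            (C₁ C₂ : ℝ),
            (∀ j, IsPhys (χ j)) ∧ (∀ j j', l2 (χ j) (χ j') = if j = j' then 1 else 0) ∧
            (∀ j, transferApply β (χ j) = μ j • χ j) ∧ 0 ≤ Λ ∧ Λ ≤ μ j₀ ∧ μ j₀ ≤ levelValue su2Rep L β 0 ∧
            (∀ ξ : GaugeConfig 3 L SU2 → ℝ, IsPhys ξ → (∀ j, l2 ξ (χ j) = 0) → l2 ξ (transferApply β ξ) ≤ Λ * l2 ξ ξ) ∧
            (∀ j, j ∉ S → μ j ≤ μ j₀) ∧ ((dressSteps L : ℝ) + 1) ^ 2 * Λ ^ (2 * dressSteps L) ≤ μ j₀ ^ (2 * dressSteps L) ∧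
            0 ≤ C₁ ∧ 0 ≤ C₂ ∧ C₁ + C₂ ≤ C ∧
            ∑ j ∈ S, (μ j - μ j₀) ^ 2 * μ j ^ (2 * dressSteps L) * l2 (liftVec β (Ω : GaugeConfig 3 L SU2 → ℝ) (g i)) (χ j) ^ 2 ≤
              C₁ * (luscherLambda β L ^ 3 / (L : ℝ) ^ 2) * levelValue su2Rep L β 0 ^ 2 *
                (μ j₀ ^ (2 * dressSteps L) * l2 (liftVec β (Ω : GaugeConfig 3 L SU2 → ℝ) (g i)) (χ j₀) ^ 2) ∧
            l2 (liftVec β (Ω : GaugeConfig 3 L SU2 → ℝ) (g i)) (liftVec β (Ω : GaugeConfig 3 L SU2 → ℝ) (g i)) -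
                ∑ j ∈ S, l2 (liftVec β (Ω : GaugeConfig 3 L SU2 → ℝ) (g i)) (χ j) ^ 2 ≤
              C₂ * luscherLambda β L ^ 3 * l2 (liftVec β (Ω : GaugeConfig 3 L SU2 → ℝ) (g i)) (χ j₀) ^ 2

/-- ★★★ **`SlowOutsideCoreForL P → LeakageForL P`** for any predicate with physical members: per lattice point XIV `leakageClause_dressed_of_slow_outside`
at the PF vacuum, then `leakageClause_iterate_iff` to every raw vacuum.  No statics, universality, width or Gram input. [cite: Luscher1983, §3]
[cite: LuscherWolff1990, §2] [cite: Kato1949, §1] -/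
theorem leakageForL_of_slowOutsideCoreForL {P : ℕ → ℝ → (Fin k → (GaugeConfig 3 1 SU2 → ℝ)) → Prop} (hP : BasisPhysL P)
    (h : SlowOutsideCoreForL P) : LeakageForL P := by
  obtain ⟨C, lam0, hC, hlam0, hk⟩ := h
  refine ⟨C, lam0, hC, hlam0, fun lam hlam hle => ?_⟩
  obtain ⟨L0, hL⟩ := hk lam hlam hle
  refine ⟨L0, fun L _ hL0 β hW φ hφ g hg => ?_⟩
  obtain ⟨Ω, θ, c, hV, hc, hcle⟩ := exists_isVacuum (L := L) β
  have hβ : 0 ≤ β := zero_le_one.trans hW.1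
  have hΩclause : LeakageClause k C β (dressedLiftFamily β (Ω : GaugeConfig 3 L SU2 → ℝ) g) :=
    leakageClause_dressed_of_slow_outside hβ hV.raw.1 (hP _ _ _ hg) (hL L hL0 β hW Ω θ c hV hc hcle g hg)
  exact (leakageClause_iterate_iff hV hφ (dressSteps L) C g).2 hΩclause

/-! ## §4 The first-moment core PER BASIS MEMBER: `FirstMomentCoreForL P` -/

/-- **`FirstMomentCoreForL P`** — `SlowOutsideCoreForL P` with the second-moment clause (SLOW) replaced by the band width (BAND)
`|μ_j − μ_{j₀}|·⟨x_i,χ_j⟩² ≤ D(λ/L)λ₀·⟨x_i,χ_j⟩²` on the slow set and the FIRST-moment admixture budget (NEAR₁)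
`Σ_{j∈S}|μ_j − μ_{j₀}|μ_j^{2L}⟨x_i,χ_j⟩² ≤ C_N(λ²/L)λ₀·μ_{j₀}^{2L}⟨x_i,χ_{j₀}⟩²` (`D, C_N ≥ 0`, `D·C_N ≤ C₁`). [cite: Luscher1983, §3] [cite: LuscherWolff1990, §2] -/
def FirstMomentCoreForL (P : ℕ → ℝ → (Fin k → (GaugeConfig 3 1 SU2 → ℝ)) → Prop) : Prop :=
  ∃ C lam0 : ℝ, 0 ≤ C ∧ 0 < lam0 ∧ ∀ lam : ℝ, 0 < lam → lam ≤ lam0 → ∃ L0 : ℕ,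
    ∀ (L : ℕ) [NeZero L], L0 ≤ L → ∀ β : ℝ, InFemtoWindow lam β L →
      ∀ (Ω : physSubmodule L) (θ c : ℝ), IsVacuum β Ω θ → 0 < c → (∀ U, c ≤ (Ω : GaugeConfig 3 L SU2 → ℝ) U) →
        ∀ g : Fin k → (GaugeConfig 3 1 SU2 → ℝ), P L (luscherLambda β L) g →
          ∀ i : Fin k, ∃ (M : ℕ) (χ : Fin M → (GaugeConfig 3 L SU2 → ℝ)) (μ : Fin M → ℝ) (Λ : ℝ) (j₀ : Fin M) (S : Finset (Fin M))
            (C₁ C₂ D C_N : ℝ),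
            (∀ j, IsPhys (χ j)) ∧ (∀ j j', l2 (χ j) (χ j') = if j = j' then 1 else 0) ∧
            (∀ j, transferApply β (χ j) = μ j • χ j) ∧ 0 ≤ Λ ∧ Λ ≤ μ j₀ ∧ μ j₀ ≤ levelValue su2Rep L β 0 ∧
            (∀ ξ : GaugeConfig 3 L SU2 → ℝ, IsPhys ξ → (∀ j, l2 ξ (χ j) = 0) → l2 ξ (transferApply β ξ) ≤ Λ * l2 ξ ξ) ∧
            (∀ j, j ∉ S → μ j ≤ μ j₀) ∧ ((dressSteps L : ℝ) + 1) ^ 2 * Λ ^ (2 * dressSteps L) ≤ μ j₀ ^ (2 * dressSteps L) ∧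
            0 ≤ C₁ ∧ 0 ≤ C₂ ∧ C₁ + C₂ ≤ C ∧ 0 ≤ D ∧ 0 ≤ C_N ∧ D * C_N ≤ C₁ ∧
            (∀ j ∈ S, |μ j - μ j₀| * l2 (liftVec β (Ω : GaugeConfig 3 L SU2 → ℝ) (g i)) (χ j) ^ 2 ≤
              D * (luscherLambda β L / L) * levelValue su2Rep L β 0 * l2 (liftVec β (Ω : GaugeConfig 3 L SU2 → ℝ) (g i)) (χ j) ^ 2) ∧
            ∑ j ∈ S, |μ j - μ j₀| * μ j ^ (2 * dressSteps L) * l2 (liftVec β (Ω : GaugeConfig 3 L SU2 → ℝ) (g i)) (χ j) ^ 2 ≤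
              C_N * (luscherLambda β L ^ 2 / L) * levelValue su2Rep L β 0 *
                (μ j₀ ^ (2 * dressSteps L) * l2 (liftVec β (Ω : GaugeConfig 3 L SU2 → ℝ) (g i)) (χ j₀) ^ 2) ∧
            l2 (liftVec β (Ω : GaugeConfig 3 L SU2 → ℝ) (g i)) (liftVec β (Ω : GaugeConfig 3 L SU2 → ℝ) (g i)) -
                ∑ j ∈ S, l2 (liftVec β (Ω : GaugeConfig 3 L SU2 → ℝ) (g i)) (χ j) ^ 2 ≤
              C₂ * luscherLambda β L ^ 3 * l2 (liftVec β (Ω : GaugeConfig 3 L SU2 → ℝ) (g i)) (χ j₀) ^ 2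

/-- ★ **`FirstMomentCoreForL P → SlowOutsideCoreForL P`**: (BAND) × (NEAR₁) ⇒ (SLOW) with `C₁ ≥ D·C_N` (`slow_of_band_firstMoment_dressed`;
`D(λ/L)λ₀ · C_N(λ²/L)λ₀ = D·C_N·(λ³/L²)λ₀²`). [cite: Luscher1983, §3] [cite: Kato1949, §1] -/
theorem slowOutsideCoreForL_of_firstMomentCoreForL {P : ℕ → ℝ → (Fin k → (GaugeConfig 3 1 SU2 → ℝ)) → Prop}
    (h : FirstMomentCoreForL P) : SlowOutsideCoreForL P := by
  obtain ⟨C, lam0, hC, hlam0, hk⟩ := h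
  refine ⟨C, lam0, hC, hlam0, fun lam hlam hle => ?_⟩
  obtain ⟨L0, hL⟩ := hk lam hlam hle
  refine ⟨L0, fun L _ hL0 β hW Ω θ c hV hc hcle g hg i => ?_⟩
  obtain ⟨M, χ, μ, Λ, j₀, S, C₁, C₂, D, C_N, hχ, hon, heig, hΛ, hΛμ, hμtop, hdom, hS, hgap, hC₁, hC₂, hCC, hD, hCN, hDC,
    hband, hnear, hout⟩ := hL L hL0 β hW Ω θ c hV hc hcle g hg i
  refine ⟨M, χ, μ, Λ, j₀, S, C₁, C₂, hχ, hon, heig, hΛ, hΛμ, hμtop, hdom, hS, hgap, hC₁, hC₂, hCC, ?_, hout⟩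
  have hlam0' : 0 ≤ luscherLambda β L := (luscherLambda_pos_of_window hlam hW).le
  have hLpos : (0 : ℝ) < L := Nat.cast_pos.mpr (NeZero.pos L)
  have hl0 : 0 ≤ levelValue su2Rep L β 0 := (levelValue_pos_of_window hW 0).le
  have hW0 : 0 ≤ D * (luscherLambda β L / L) * levelValue su2Rep L β 0 := mul_nonneg (mul_nonneg hD (div_nonneg hlam0' hLpos.le)) hl0
  set x := liftVec β (Ω : GaugeConfig 3 L SU2 → ℝ) (g i) with hx
  have hslow := slow_of_band_firstMoment_dressed S μ (fun j => l2 x (χ j)) (μ j₀) _ _ (dressSteps L) hW0 hband hnear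
  have hX : 0 ≤ (luscherLambda β L ^ 3 / (L : ℝ) ^ 2) * levelValue su2Rep L β 0 ^ 2 * (μ j₀ ^ (2 * dressSteps L) * l2 x (χ j₀) ^ 2) :=
    mul_nonneg (mul_nonneg (div_nonneg (pow_nonneg hlam0' 3) (sq_nonneg _)) (sq_nonneg _))
      (mul_nonneg (by rw [pow_mul']; exact sq_nonneg _) (sq_nonneg _))
  calc ∑ j ∈ S, (μ j - μ j₀) ^ 2 * μ j ^ (2 * dressSteps L) * l2 x (χ j) ^ 2
      ≤ D * (luscherLambda β L / L) * levelValue su2Rep L β 0 *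
          (C_N * (luscherLambda β L ^ 2 / L) * levelValue su2Rep L β 0 * (μ j₀ ^ (2 * dressSteps L) * l2 x (χ j₀) ^ 2)) := hslow
    _ = (D * C_N) * ((luscherLambda β L ^ 3 / (L : ℝ) ^ 2) * levelValue su2Rep L β 0 ^ 2 * (μ j₀ ^ (2 * dressSteps L) * l2 x (χ j₀) ^ 2)) := by
        field_simp
    _ ≤ C₁ * ((luscherLambda β L ^ 3 / (L : ℝ) ^ 2) * levelValue su2Rep L β 0 ^ 2 * (μ j₀ ^ (2 * dressSteps L) * l2 x (χ j₀) ^ 2)) :=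
        mul_le_mul_of_nonneg_right hDC hX
    _ = C₁ * (luscherLambda β L ^ 3 / (L : ℝ) ^ 2) * levelValue su2Rep L β 0 ^ 2 * (μ j₀ ^ (2 * dressSteps L) * l2 x (χ j₀) ^ 2) := by
        ring

/-- ★★★ **`FirstMomentCoreForL P → LeakageForL P`** (members physical): S-LEAK for the predicate `P` is of FIRST-MOMENT grade — the time-dressing `K_β^[L]`
supplies every `L⁻²`. [cite: Luscher1983, §3] [cite: LuscherWolff1990, §2] [cite: Kato1949, §1] -/
theorem leakageForL_of_firstMomentCoreForL {P : ℕ → ℝ → (Fin k → (GaugeConfig 3 1 SU2 → ℝ)) → Prop} (hP : BasisPhysL P)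
    (h : FirstMomentCoreForL P) : LeakageForL P :=
  leakageForL_of_slowOutsideCoreForL hP (slowOutsideCoreForL_of_firstMomentCoreForL h)

/-! ## §5 Euclidean currency -/

/-- **`EuclideanLeakageForL P`** — `LeakageForL P` in Euclidean currency: deep in the femto window, for every raw vacuum `φ` and every `P`-basis `g`,
with `c = corr β φ (flowLiftAt 0 (flowTime β L) ∘ g)` and `m = dressSteps L`, for every channel
(E4) `c(2m+2)_{ii}·c(2m)_{ii} − c(2m+1)_{ii}² ≤ C(λ³/L²)·c(2m)_{ii}²`. [cite: LuscherWolff1990, §2] [cite: Luscher1983, §3] -/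
def EuclideanLeakageForL (P : ℕ → ℝ → (Fin k → (GaugeConfig 3 1 SU2 → ℝ)) → Prop) : Prop :=
  ∃ C lam0 : ℝ, 0 ≤ C ∧ 0 < lam0 ∧ ∀ lam : ℝ, 0 < lam → lam ≤ lam0 → ∃ L0 : ℕ,
    ∀ (L : ℕ) [NeZero L], L0 ≤ L → ∀ β : ℝ, InFemtoWindow lam β L →
      ∀ φ : GaugeConfig 3 L SU2 → ℝ, IsRawVacuum β φ →
        ∀ g : Fin k → (GaugeConfig 3 1 SU2 → ℝ), P L (luscherLambda β L) g →
          let c := corr β φ (fun i => flowLiftAt (L := L) 0 (flowTime β L) (g i))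
          let m := dressSteps L
          ∀ i : Fin k, c (2 * m + 2) i i * c (2 * m) i i - c (2 * m + 1) i i ^ 2 ≤ C * (luscherLambda β L ^ 3 / (L : ℝ) ^ 2) * c (2 * m) i i ^ 2

/-- ★ **`LeakageForL P ↔ EuclideanLeakageForL P`** (members physical; same `C`, `lam0`, `L0`), by XII `leakageClause_iff_euclidean` per lattice point.
[cite: LuscherWolff1990, §2] [cite: Kato1949, §1] -/
theorem leakageForL_iff_euclideanForL {P : ℕ → ℝ → (Fin k → (GaugeConfig 3 1 SU2 → ℝ)) → Prop} (hP : BasisPhysL P) :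
    LeakageForL P ↔ EuclideanLeakageForL P := by
  unfold LeakageForL EuclideanLeakageForL
  refine exists_congr fun C => exists_congr fun lam0 => and_congr_right fun _ => and_congr_right fun _ => ?_
  refine forall_congr' fun lam => forall_congr' fun hlam => forall_congr' fun _ => exists_congr fun L0 => ?_
  refine forall_congr' fun L => forall_congr' fun _ => forall_congr' fun _ => forall_congr' fun β => forall_congr' fun hW => ?_
  refine forall_congr' fun φ => forall_congr' fun hφ => forall_congr' fun g => forall_congr' fun hg => ?_
  have hβ : 0 < β := zero_lt_one.trans_le hW.1
  exact leakageClause_iff_euclidean (C := C) hβ hφ.1 (hP _ _ _ hg)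

/-! ## §6 The cores are antitone in the predicate -/

/-- `SlowOutsideCoreForL` is antitone in the basis predicate. [folklore] -/
theorem slowOutsideCoreForL_of_imp {P P' : ℕ → ℝ → (Fin k → (GaugeConfig 3 1 SU2 → ℝ)) → Prop} (hPP' : ∀ L Λ g, P L Λ g → P' L Λ g)
    (h : SlowOutsideCoreForL P') : SlowOutsideCoreForL P := by
  obtain ⟨C, lam0, hC, hlam0, hk⟩ := h
  refine ⟨C, lam0, hC, hlam0, fun lam hlam hle => ?_⟩
  obtain ⟨L0, hL⟩ := hk lam hlam hle
  exact ⟨L0, fun L _ hL0 β hW Ω θ c hV hc hcle g hg => hL L hL0 β hW Ω θ c hV hc hcle g (hPP' _ _ _ hg)⟩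

/-- `FirstMomentCoreForL` is antitone in the basis predicate. [folklore] -/
theorem firstMomentCoreForL_of_imp {P P' : ℕ → ℝ → (Fin k → (GaugeConfig 3 1 SU2 → ℝ)) → Prop} (hPP' : ∀ L Λ g, P L Λ g → P' L Λ g)
    (h : FirstMomentCoreForL P') : FirstMomentCoreForL P := by
  obtain ⟨C, lam0, hC, hlam0, hk⟩ := h
  refine ⟨C, lam0, hC, hlam0, fun lam hlam hle => ?_⟩
  obtain ⟨L0, hL⟩ := hk lam hlam hle
  exact ⟨L0, fun L _ hL0 β hW Ω θ c hV hc hcle g hg => hL L hL0 β hW Ω θ c hV hc hcle g (hPP' _ _ _ hg)⟩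

/-- `EuclideanLeakageForL` is antitone in the basis predicate. [folklore] -/
theorem euclideanLeakageForL_of_imp {P P' : ℕ → ℝ → (Fin k → (GaugeConfig 3 1 SU2 → ℝ)) → Prop} (hPP' : ∀ L Λ g, P L Λ g → P' L Λ g)
    (h : EuclideanLeakageForL P') : EuclideanLeakageForL P := by
  obtain ⟨C, lam0, hC, hlam0, hk⟩ := h
  refine ⟨C, lam0, hC, hlam0, fun lam hlam hle => ?_⟩
  obtain ⟨L0, hL⟩ := hk lam hlam hle
  exact ⟨L0, fun L _ hL0 β hW φ hφ g hg => hL L hL0 β hW φ hφ g (hPP' _ _ _ hg)⟩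


/-! ## §7 `L`-blind predicates give back the XXII cores -/

/-- `SlowOutsideCoreForL (fun _ => P) ↔ SlowOutsideCoreFor P`. [folklore] -/
theorem slowOutsideCoreForL_const_iff (P : ℝ → (Fin k → (GaugeConfig 3 1 SU2 → ℝ)) → Prop) :
    SlowOutsideCoreForL (fun _ => P) ↔ SlowOutsideCoreFor P := Iff.rfl

/-- `FirstMomentCoreForL (fun _ => P) ↔ FirstMomentCoreFor P`. [folklore] -/
theorem firstMomentCoreForL_const_iff (P : ℝ → (Fin k → (GaugeConfig 3 1 SU2 → ℝ)) → Prop) :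
    FirstMomentCoreForL (fun _ => P) ↔ FirstMomentCoreFor P := Iff.rfl

/-- `EuclideanLeakageForL (fun _ => P) ↔ EuclideanLeakageFor P`. [folklore] -/
theorem euclideanLeakageForL_const_iff (P : ℝ → (Fin k → (GaugeConfig 3 1 SU2 → ℝ)) → Prop) :
    EuclideanLeakageForL (fun _ => P) ↔ EuclideanLeakageFor P := Iff.rfl

/-! ## §8 The REGISTERED r6 S-LEAK text `∀ k, LeakageForL (TransplantBasisL k)` by name -/

/-- At `k = 0` (no excited channel) `LeakageForL P` holds for every predicate, with `C = 0`. [folklore] -/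
theorem leakageForL_zero (P : ℕ → ℝ → (Fin 0 → (GaugeConfig 3 1 SU2 → ℝ)) → Prop) : LeakageForL P :=
  ⟨0, 1, le_rfl, one_pos, fun _ _ _ => ⟨0, fun _ _ _ _ _ _ _ _ _ i => i.elim0⟩⟩

/-- ★★★ **`(∀ k, FirstMomentCoreForL (TransplantBasisL k)) → ∀ k, LeakageForL (TransplantBasisL k)`** — the REGISTERED r6 text of `Stmt.stub_liftLeakage`
(skeleton sha16 09c950a55cd7b1f3) from the per-member first-moment core; members physical by `basisPhysL_transplantBasisL`. [cite: Luscher1983, §3] [cite: LuscherWolff1990, §2] -/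
theorem r6Leakage_of_firstMomentCoreForL (h : ∀ k : ℕ, FirstMomentCoreForL (TransplantBasisL k)) :
    ∀ k : ℕ, LeakageForL (TransplantBasisL k) :=
  fun k => leakageForL_of_firstMomentCoreForL (basisPhysL_transplantBasisL k) (h k)

/-- ★★ **`(∀ k, SlowOutsideCoreForL (TransplantBasisL k)) → ∀ k, LeakageForL (TransplantBasisL k)`** (second-moment form). [cite: Luscher1983, §3] [cite: LuscherWolff1990, §2] -/
theorem r6Leakage_of_slowOutsideCoreForL (h : ∀ k : ℕ, SlowOutsideCoreForL (TransplantBasisL k)) :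
    ∀ k : ℕ, LeakageForL (TransplantBasisL k) :=
  fun k => leakageForL_of_slowOutsideCoreForL (basisPhysL_transplantBasisL k) (h k)

/-- ★ **The registered text in Euclidean currency**: `(∀ k, LeakageForL (TransplantBasisL k)) ↔ ∀ k, EuclideanLeakageForL (TransplantBasisL k)` — (E4), the
log-convexity defect of the normalised connected autocorrelation of the root-transplanted flowed-Polyakov insertion at separation `2L+1` is `≤ C(λ³/L²)` relative.
[cite: LuscherWolff1990, §2] -/
theorem r6Leakage_iff_euclidean :
    (∀ k : ℕ, LeakageForL (TransplantBasisL k)) ↔ ∀ k : ℕ, EuclideanLeakageForL (TransplantBasisL k) :=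
  forall_congr' fun k => leakageForL_iff_euclideanForL (basisPhysL_transplantBasisL k)

/-- **Sub-predicates inherit the registered text** (e.g. a further pinned radius or a symmetry-adapted sub-class of eigenfamilies). [folklore] -/
theorem r6Leakage_of_imp {Q : (k : ℕ) → ℕ → ℝ → (Fin k → (GaugeConfig 3 1 SU2 → ℝ)) → Prop}
    (hQ : ∀ k L Λ g, Q k L Λ g → TransplantBasisL k L Λ g) (h : ∀ k : ℕ, LeakageForL (TransplantBasisL k)) : ∀ k : ℕ, LeakageForL (Q k) :=
  fun k => leakageForL_of_imp (hQ k) (h k)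

end Summit.QuantumFields.YangMills.Theorems.FemtoTransferGap.LiftLeak

end
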